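import Mathlib
import HarnessLib
import Literature.NumberTheory.GelbartRogawski1991.WeilRepresentationsAPackets

/-!
# Gelbart–Rogawski 1991, §2 (pp. 451–452) — the DATUM: Fourier–Jacobi coefficients along `U`, the
# spectrum `R^∧` of `L²(R(F)\R(𝔸))` with its central characters, `B(F)`-action and character twists,
# the `τ`-components `φ_τ` and `Λ(π)` — ONE structure `GR91RData` over the ★ dictionary
# `GR91Spectrum`, plus the objects §2 DEFINES, as real definitions (squad TG carrier file
# `Sec2Defs`; the printed ASSERTIONS of §2 are the predicates of `Sec2.lean`, which imports this)

Source: S. Gelbart, J. Rogawski, *L-functions and Fourier–Jacobi coefficients for the unitary group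
`U(3)`*, Invent. Math. **105** (1991) 445–472 [GelbartRogawski1991], §2 «Fourier expansions and
exceptional automorphic forms», printed pages 451–452.  Every quotation «…» was read on the page
IMAGES of the printed article (open GDZ digitisation PPN356556735_0105, canvas = page + 6; images +
OCR at `run/shared/lean/pub/pub-hodgecm/pub-hodgecm-cf-rogawski-g6/lit/GR91-invent105/`; the OCR was
used only to locate).  «p. N» = printed page, «¶k» = k-th paragraph of the page body.

SCOPE (printed, §1.1 p. 449): `E/F` a quadratic extension of NUMBER FIELDS; `G` = the QUASI-SPLIT
`U(3)` of `Φ = antidiag(1, ξ, −1)`; «`Z` = center of `G` · `B` = standard Borel subgroup of upper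
triangular matrices in `G` · `N` = unipotent radical of `B` · `M` = diagonal subgroup of `G` · `U` =
center of `N` · `R` = centralizer of `U` in `B`»; «`ψ` will denote a non-trivial additive character
of `F\𝔸`»; §1.2 p. 450 «If `π` is a representation, `V_π` will denote the space on which `π` acts».

## Transcription level

Mathlib has no automorphic forms on `U(3)` and no `L²(R(F)\R(𝔸))`.  This file POSITS, as the fields
of ONE structure `GR91RData X GA` over the ★ dictionary `X : GR91Spectrum`
(`WeilRepresentationsAPackets.lean` — imported, NOT re-posited: `X.Rep`, `X.IsDiscrete`,
`X.IsExceptional`, `X.AddChar`, `X.NormClassEq`, `X.Char1` are reused) and an ambient group `GA`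
[= `G(𝔸)`, its `Group` structure taken from the context — no instance is declared here], exactly the
objects §2 speaks about and does not construct: the subgroups `G(F), U(𝔸), N(𝔸), R(𝔸), B(𝔸)`; the
automorphic forms and the spaces `V_π`; the three compact-quotient integrals; `ψ` on `U(F)\U(𝔸)`;
the irreducible constituents of `L²(R(F)\R(𝔸))`, REPRESENTED BY THEIR SUBSPACES OF SMOOTH FUNCTIONS
on `R(𝔸)` (so that «multiplicity one», Thm 2.2.1 in `Sec2.lean`, reads: isomorphic constituents are
EQUAL); the `τ`-projections; the characters of
`R(F)N(𝔸)\R(𝔸) = (E¹\E¹_𝔸)²`; and the printed action of `B(F)` on `R^∧`.  Everything §2 DEFINES over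
these is a REAL DEFINITION here (class **DEF**, verbatim quotation + locator): `φ_ψ` (2.1.1), `φ_U`,
`φ_N`, `R^∧`, «`U(𝔸)` acts via `ψ`», `R^∧(ψ)`, equivariant isomorphy of constituents (`IsoR`, `IsoN`),
the twist `τ ⊗ ν`, `φ_τ`, `Λ(π)`, `B(F)`-orbits (`SameOrbit`, `IsSingleBOrbit`).  NOTHING IS
ASSERTED in this file (no `Prop`-valued statement of the paper; those are in `Sec2.lean`, and §3.3–3.4
items over this datum are in `Sec3Theta.lean`).  The only `Prop` fields are definitional: the two
subgroup inclusions `U ⊆ N ⊆ R` of §1.1 (needed to WRITE «`U(𝔸)` acts») and `V_π ⊆` automorphic forms.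

## References

* S. Gelbart, J. Rogawski, Invent. Math. 105 (1991) 445–472, §1.1 p. 449, §2.1–2.3 pp. 451–452.
  [GelbartRogawski1991]
-/

noncomputable section

namespace Literature.NumberTheory.GelbartRogawski1991.Sec2Defs

universe u

/-- **Posited GLOBAL primitives of §2** over the ★ dictionary `X : GR91Spectrum` (quasi-split
`G = U(3)` of `E/F`) and an ambient group `GA` standing for `G(𝔸)`.  Fields, with the printed
meaning (§1.1 p. 449, §2.1–§2.3 pp. 451–452):
* `GF` — `G(F) ⊆ G(𝔸)`; `U`, `N`, `R`, `B` — the adelic points `U(𝔸) ⊆ N(𝔸) ⊆ R(𝔸) ⊆ B(𝔸)` of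
  «`B` = standard Borel subgroup … `N` = unipotent radical of `B` … `U` = center of `N` · `R` =
  centralizer of `U` in `B`» (so `B(F) = B ⊓ GF`, etc.); `U_le_N`, `N_le_R` record the two
  inclusions that hold by these definitions and are needed to write the statements;
* `autForm` — the space of automorphic forms on `G(𝔸)` («Let `φ` be an automorphic form on
  `G(𝔸)`», §2.1), as a subspace of the functions `G(𝔸) → ℂ`;
* `form π` — for a discrete `π : X.Rep`, «`V_π` … the space on which `π` acts» (§1.2 p. 450),
  realised in the automorphic forms (p. 452 L1: «`φ_τ ≠ 0` for some `φ ∈ V_π`»; the definitional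
  inclusion `V_π ⊆` automorphic forms is the field `form_le_autForm`); unspecified for non-discrete
  `π`;
* `psiU ψ` — the non-trivial character `ψ` of `F\𝔸` viewed «as a character of `U(F)\U(𝔸)`» (§2.1;
  `U ≅ 𝔾_a`);
* `intU f = ∫_{U(F)\U(𝔸)} f(u) du`, `intN f = ∫_{N(F)\N(𝔸)} f(n) dn`, `intNU f = ∫_{N(F)U(𝔸)\N(𝔸)} f(n) dn`
  — the invariant integrals over the three compact quotients (§2.1 p. 451), as functionals on
  functions on `U(𝔸)`, resp. `N(𝔸)` (meaningful on left-`U(F)`-, resp. `N(F)`-, `N(F)U(𝔸)`-invariant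
  integrable functions; unspecified elsewhere);
* `IsConstituent S` — `S` is (the space of smooth functions of) an irreducible closed
  `R(𝔸)`-invariant subspace of `L²(R(F)\R(𝔸))`, `R(𝔸)` acting by right translation («irreducible
  constituent of `L²(R(F)\R(𝔸))`», Thm 2.2.1; «subrepresentations of `L²(R(F)\R(𝔸))`», §2.2) — a
  constituent is recorded by its SUBSPACE, not by its isomorphism class;
* `proj τ f` — «the projection … onto the `τ`-subspace of `L²(R(F)\R(𝔸))` (uniquely defined by
  Theorem 2.2.1)» of a function `f` on `R(F)\R(𝔸)` (§2.3 p. 451), as a function on `R(𝔸)`;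
* `charRN ν` — the character of `R(𝔸)` trivial on `R(F)N(𝔸)` attached to a pair `ν = (ν₁, ν₂)` of
  automorphic characters of `E¹` (§2.2 p. 451: «`ν` is trivial on `R(F)`, and hence can be viewed as
  an automorphic character of `(E¹\E¹_𝔸)²` (cf. §2.5)»; p. 454 L9–10:
  «`R_F N(𝔸)\R(𝔸) = (E¹\E¹_𝔸)²`»);
* `bAct b τ` — the printed action of `b ∈ B(F)` on `R^∧` (p. 452 ¶1: «Observe that `R` is normal in
  `B` and `B(F)` acts on `R^∧`»; written `τ ↦ τb` in print), extended to all subspaces.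
[cite: GelbartRogawski1991, §1.1 p. 449; §2.1–§2.3 pp. 451–452] -/
structure GR91RData (X : GR91Spectrum.{u}) (GA : Type u) [Group GA] : Type u where
  /-- `G(F) ⊆ G(𝔸)` -/
  GF : Subgroup GA
  /-- `U(𝔸)`, `U` = center of `N` -/
  U : Subgroup GA
  /-- `N(𝔸)`, `N` = unipotent radical of `B` (a Heisenberg group with center `U`) -/
  N : Subgroup GA
  /-- `R(𝔸)`, `R` = centralizer of `U` in `B` -/
  R : Subgroup GA
  /-- `B(𝔸)`, `B` = standard Borel subgroup -/
  B : Subgroup GA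
  /-- `U ⊆ N` (by definition of `U`) -/
  U_le_N : U ≤ N
  /-- `N ⊆ R` (by definition of `R`: `U` is central in `N`) -/
  N_le_R : N ≤ R
  /-- automorphic forms on `G(𝔸)` -/
  autForm : Submodule ℂ (GA → ℂ)
  /-- `V_π`, for discrete `π` -/
  form : X.Rep → Submodule ℂ (GA → ℂ)
  /-- `V_π ⊆` automorphic forms (by definition of a discrete automorphic representation) -/
  form_le_autForm : ∀ π : X.Rep, form π ≤ autForm
  /-- `ψ` as a character of `U(F)\U(𝔸)` -/
  psiU : X.AddChar → U → ℂ
  /-- `∫_{U(F)\U(𝔸)}` -/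
  intU : (U → ℂ) → ℂ
  /-- `∫_{N(F)\N(𝔸)}` -/
  intN : (N → ℂ) → ℂ
  /-- `∫_{N(F)U(𝔸)\N(𝔸)}` -/
  intNU : (N → ℂ) → ℂ
  /-- irreducible constituents of `L²(R(F)\R(𝔸))`, by their subspaces of smooth functions -/
  IsConstituent : Submodule ℂ (R → ℂ) → Prop
  /-- projection onto the `τ`-subspace -/
  proj : Submodule ℂ (R → ℂ) → (R → ℂ) → (R → ℂ)
  /-- characters of `R(F)N(𝔸)\R(𝔸) = (E¹\E¹_𝔸)²` -/
  charRN : X.Char1 × X.Char1 → R → ℂ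
  /-- the action of `B(F) = B ⊓ G(F)` on `R^∧` -/
  bAct : ↥(B ⊓ GF) → Submodule ℂ (R → ℂ) → Submodule ℂ (R → ℂ)

namespace GR91RData

variable {X : GR91Spectrum.{u}} {GA : Type u} [Group GA] (J : GR91RData X GA)

/-- **DEF (2.1.1)** «define (2.1.1) `φ_ψ(g) = ∫_{U(F)\U(𝔸)} φ(ug) ψ(u) du`. This is the `ψ`th
*Fourier-Jacobi coefficient* of `φ` along `U`.» [cite: GelbartRogawski1991, §2.1 (2.1.1) (p. 451 L8–12)] -/
def fj (ψ : X.AddChar) (φ : GA → ℂ) : GA → ℂ :=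
  fun g => J.intU (fun u => φ ((u : GA) * g) * J.psiU ψ u)

/-- **DEF** «The constant term `φ_U` of `φ` along `U` is defined similarly by `∫ φ(ug) du`.»
[cite: GelbartRogawski1991, §2.1 (p. 451 L12–13)] -/
def constU (φ : GA → ℂ) : GA → ℂ :=
  fun g => J.intU (fun u => φ ((u : GA) * g))

/-- **DEF** the constant term along `N`: «`φ_N(g) = ∫_{N(F)\N(𝔸)} φ(ng) dn`».
[cite: GelbartRogawski1991, §2.1 (p. 451 L17–18)] -/
def constN (φ : GA → ℂ) : GA → ℂ :=
  fun g => J.intN (fun n => φ ((n : GA) * g))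

/-- **DEF** «Let `R^∧` be the set of infinite-dimensional representations of `R(𝔸)` which occur as
subrepresentations of `L²(R(F) \ R(𝔸))`.» — the infinite-dimensional irreducible constituents (by
their subspaces; Theorem 2.2.1 makes «the `τ`-subspace» unique, §2.3).
[cite: GelbartRogawski1991, §2.2 (p. 451 L19–20)] -/
def RHat : Set (Submodule ℂ (J.R → ℂ)) :=
  {τ | J.IsConstituent τ ∧ ¬ Module.Finite ℂ τ}

/-- the inclusion `U(𝔸) ⊆ R(𝔸)` (`U ⊆ N ⊆ R`). [cite: GelbartRogawski1991, §1.1 (p. 449)] -/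
def inclUR : J.U →* J.R :=
  Subgroup.inclusion (J.U_le_N.trans J.N_le_R)

/-- **DEF** «on which `U(𝔸)` acts via `ψ`» (§2.2): right translation by `u ∈ U(𝔸)` multiplies every
function of `S` by `ψ(u)`. [cite: GelbartRogawski1991, §2.2 (p. 451)] -/
def UActsVia (S : Submodule ℂ (J.R → ℂ)) (ψ : X.AddChar) : Prop :=
  ∀ f ∈ S, ∀ (u : J.U) (r : J.R), f (r * J.inclUR u) = J.psiU ψ u * f r

/-- **DEF** «The constituents on which `U(𝔸)` acts trivially» (§2.5 p. 453): right translation by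
`U(𝔸)` fixes every function of `S`. [cite: GelbartRogawski1991, §2.5 (p. 453 L22)] -/
def UActsTriv (S : Submodule ℂ (J.R → ℂ)) : Prop :=
  ∀ f ∈ S, ∀ (u : J.U) (r : J.R), f (r * J.inclUR u) = f r

/-- **DEF** «Let `R^∧(ψ)` be the set of elements of `R^∧` on which `U(𝔸)` acts via `ψ`.»
[cite: GelbartRogawski1991, §2.2 (p. 451 L24)] -/
def RHatPsi (ψ : X.AddChar) : Set (Submodule ℂ (J.R → ℂ)) :=
  {τ | τ ∈ J.RHat ∧ J.UActsVia τ ψ}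

/-- right translation of functions on `R(𝔸)`: `(r₀ · f)(r) = f(r r₀)` — the action of `R(𝔸)` on
`L²(R(F)\R(𝔸))`. [cite: GelbartRogawski1991, §2.2 (p. 451)] -/
def rtrans (r₀ : J.R) (f : J.R → ℂ) : J.R → ℂ :=
  fun r => f (r * r₀)

/-- **DEF** «isomorphic» for subrepresentations realised as subspaces of functions on `R(𝔸)`: a
`ℂ`-linear isomorphism `S₁ ≃ S₂` intertwining right translation by every `r₀ ∈ T`
(`T = R(𝔸)`: isomorphic as representations of `R(𝔸)`; `T = N(𝔸)`: as representations of `N(𝔸)`).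
The intertwining clause is asked only at vectors whose translate stays in `S₁` — vacuous on a
non-invariant `S₁`, immaterial on constituents (which are `R(𝔸)`-invariant by meaning of
`IsConstituent`). [cite: GelbartRogawski1991, §2.2 (p. 451)] -/
def EquivIso (T : Set J.R) (S₁ S₂ : Submodule ℂ (J.R → ℂ)) : Prop :=
  ∃ e : S₁ ≃ₗ[ℂ] S₂, ∀ r₀ ∈ T, ∀ (f : S₁) (hf : J.rtrans r₀ (f : J.R → ℂ) ∈ S₁),
    ((e ⟨J.rtrans r₀ (f : J.R → ℂ), hf⟩ : S₂) : J.R → ℂ) = J.rtrans r₀ ((e f : S₂) : J.R → ℂ)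

/-- **DEF** isomorphic as representations of `R(𝔸)`. [cite: GelbartRogawski1991, §2.2 (p. 451)] -/
def IsoR (S₁ S₂ : Submodule ℂ (J.R → ℂ)) : Prop :=
  J.EquivIso Set.univ S₁ S₂

/-- **DEF** isomorphic as representations of `N(𝔸)` (restrictions to the Heisenberg group).
[cite: GelbartRogawski1991, §2.2 (p. 451)] -/
def IsoN (S₁ S₂ : Submodule ℂ (J.R → ℂ)) : Prop :=
  J.EquivIso {r₀ | (r₀ : GA) ∈ J.N} S₁ S₂

/-- **DEF** the twist `τ ⊗ ν` of a subspace of functions on `R(𝔸)` by the character `ν` of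
`R(F)N(𝔸)\R(𝔸) = (E¹\E¹_𝔸)²`: `{φ ν : φ ∈ τ}` (§2.5 p. 453: «there is a character `ν` of
`R_F N(𝔸) \ R(𝔸)` such that `V₁ = {φν : φ ∈ V₀}`»). [cite: GelbartRogawski1991, §2.2 (p. 451); §2.5 (p. 453)] -/
def twist (ν : X.Char1 × X.Char1) (S : Submodule ℂ (J.R → ℂ)) : Submodule ℂ (J.R → ℂ) :=
  S.map (LinearMap.mulLeft ℂ (J.charRN ν))

/-- **DEF** «For `τ ∈ R^∧(ψ)`, let `φ_τ(rg)` be the projection of the function `r → φ_ψ(rg)` onto the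
`τ`-subspace of `L²(R(F) \ R(𝔸))` (uniquely defined by Theorem 2.2.1)» (§2.1: «the function
`r → φ_ψ(rg)` belongs to `L²(R(F) \ R(𝔸))` for all `g ∈ G(𝔸)`»).  `ψ` is the printed parameter
(`τ ∈ R^∧(ψ)`).  As a function on `G(𝔸)`: `φ_τ(x)` = the `τ`-projection of `r ↦ φ_ψ(r x)` evaluated
at `r = 1` (the projection commutes with right translation by `R(𝔸)` — see `Sec2.proj_rtrans` —, so
`φ_τ(r x)` is the projection evaluated at `r`, as printed). [cite: GelbartRogawski1991, §2.3 (p. 451 L31–32)] -/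
def fjTau (ψ : X.AddChar) (τ : Submodule ℂ (J.R → ℂ)) (φ : GA → ℂ) : GA → ℂ :=
  fun x => J.proj τ (fun r => J.fj ψ φ ((r : GA) * x)) 1

/-- **DEF** «If `π` is a discrete representation, set `Λ(π) = {τ ∈ R^∧ : φ_τ ≠ 0` for some
`φ ∈ V_π}`.» (`φ_τ` taken for the `ψ` with `τ ∈ R^∧(ψ)`, §2.3).
[cite: GelbartRogawski1991, §2.3 (p. 452 L1–2)] -/
def Lambda (π : X.Rep) : Set (Submodule ℂ (J.R → ℂ)) :=
  {τ | ∃ ψ : X.AddChar, τ ∈ J.RHatPsi ψ ∧ ∃ φ ∈ J.form π, J.fjTau ψ τ φ ≠ 0}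

/-- **DEF** «`Λ(π)` is a single `B(F)`-orbit» (condition (1) of Definition 2.3.1): `S` is the
`B(F)`-orbit of one of its elements. [cite: GelbartRogawski1991, Def. 2.3.1 (1) (p. 452 L6–8)] -/
def IsSingleBOrbit (S : Set (Submodule ℂ (J.R → ℂ))) : Prop :=
  ∃ τ₀ ∈ S, S = {τ | ∃ b : ↥(J.B ⊓ J.GF), J.bAct b τ₀ = τ}

/-- **DEF** «`B(F)` acts on `R^∧`» (p. 452 ¶1): `τ₁`, `τ₂` lie in the same `B(F)`-orbit.
[cite: GelbartRogawski1991, §2.3 (p. 452 L3–5)] -/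
def SameOrbit (τ₁ τ₂ : Submodule ℂ (J.R → ℂ)) : Prop :=
  ∃ b : ↥(J.B ⊓ J.GF), J.bAct b τ₁ = τ₂

end GR91RData

end Literature.NumberTheory.GelbartRogawski1991.Sec2Defs

end
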